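import Literature.Computability.Complexity.PaulPippengerSzemerediTrotter1983Blocks
import HarnessLib

/-!
# Frames: a `TM2` step acts on the tops of its stacks (locality of block re-simulation; PPST 1983, §3)

Literature / complexity toolkit, eighth brick of the inline formalization of
Paul–Pippenger–Szemerédi–Trotter 1983 (`PaulPippengerSzemerediTrotter1983.lean`, fact
`PaulEtAl1983_NTIME_not_subset_DTIME`; roadmap Layer 4, its mathematical core). The
four-alternation simulation re-runs ONE time block of a deterministic computation from guessed
data: the finite control at the block's start and the contents of the few height blocks the
time block touches — a TOP SEGMENT of each stack. That this is legitimate is the locality of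
Mathlib's `TM2` semantics proved here: a statement reading at most `popBound` symbols deep
(`…Blocks.lean`) acts on stacks `U k ++ L k` exactly as on the top segments `U k`, carrying the
hidden bottoms `L k` along untouched, as soon as `|U k| ≥ popBound` wherever `L k ≠ ε`; hence a
run whose heights stay `Q` above the cut (as the true run does above the lowest touched height
block, by the very definition of `TM2Blocks.lo`) is the truncated run with the bottoms appended.

* `TM2Frames.appendBot L c` — the configuration `c` with the hidden bottoms `L` appended;
* **`stepAux_append`** — `TM2.stepAux q v (U ++ L) = appendBot L (TM2.stepAux q v U)` when
  `popBound q ≤ |U k|` for every `k` with `L k ≠ ε` (induction on the statement: `push`, `peek`,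
  `pop` touch only the top segment);
* `step_append`, `stepT_append` — the same for one (total) step of a `FinTM2`
  (`machinePopBound`);
* **`run_append`** — if along the full run the height of every stack with a hidden bottom stays
  at least `Q + |L k|` before each of the first `n` steps, then for all `t ≤ n` the full run is the
  truncated run with the bottoms appended (the block re-simulation lemma);
  **`run_append_of_truncated`** — the same with the room condition tested on the truncated run
  (the verifier's form).

No named fact is introduced (definitions with bodies and theorems only).

## References

* W. J. Paul, N. Pippenger, E. Szemerédi, W. T. Trotter, *On determinism versus non-determinism
  and related problems*, FOCS 1983, 429–438, §3 (re-simulation of a block from the contents of the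
  blocks it depends on) [PaulEtAl1983].
* R. Santhanam, *On separators, segregators and time versus space*, CCC 2001, §1 (p. 2: "we say a
  block is associated with a vertex `i` of the graph if it is scanned during time interval `i`")
  [Santhanam2001].
-/

namespace Literature.Computability.Complexity

open Turing Function

namespace TM2Frames

section Stmt

variable {K : Type} {Γ : K → Type} {Λ σ : Type}

/-- Appending hidden bottoms to the stacks of a configuration. [folklore] -/
def appendBot (L : ∀ k, List (Γ k)) (c : TM2.Cfg Γ Λ σ) : TM2.Cfg Γ Λ σ :=
  ⟨c.l, c.var, fun k => c.stk k ++ L k⟩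

/-- `appendBot` on the components. [folklore] -/
@[simp] theorem appendBot_mk (L : ∀ k, List (Γ k)) (l : Option Λ) (v : σ) (S : ∀ k, List (Γ k)) :
    appendBot L ⟨l, v, S⟩ = ⟨l, v, fun k => S k ++ L k⟩ := rfl

/-- The label is unchanged. [folklore] -/
@[simp] theorem appendBot_l (L : ∀ k, List (Γ k)) (c : TM2.Cfg Γ Λ σ) : (appendBot L c).l = c.l := rfl

/-- The internal state is unchanged. [folklore] -/
@[simp] theorem appendBot_var (L : ∀ k, List (Γ k)) (c : TM2.Cfg Γ Λ σ) :
    (appendBot L c).var = c.var := rfl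

/-- The stacks. [folklore] -/
@[simp] theorem appendBot_stk (L : ∀ k, List (Γ k)) (c : TM2.Cfg Γ Λ σ) (k : K) :
    (appendBot L c).stk k = c.stk k ++ L k := rfl

variable [DecidableEq K]

/-- Updating a stack commutes with appending the bottoms. [folklore] -/
theorem update_append (U L : ∀ k, List (Γ k)) (k' : K) (w : List (Γ k')) :
    update (fun k => U k ++ L k) k' (w ++ L k') = fun k => update U k' w k ++ L k := by
  funext k
  rcases eq_or_ne k k' with rfl | h
  · simp
  · simp [update_of_ne h]

/-- The top symbol of `U ++ L` is that of `U` when `U` is nonempty or `L` is empty. [folklore] -/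
theorem head?_append_of {α : Type} (U L : List α) (h : L ≠ [] → 1 ≤ U.length) :
    (U ++ L).head? = U.head? := by
  cases U with
  | nil =>
    cases L with
    | nil => rfl
    | cons a L => exact absurd (h (List.cons_ne_nil a L)) (by simp)
  | cons u U => rfl

/-- The tail of `U ++ L` is `U.tail ++ L` when `U` is nonempty or `L` is empty. [folklore] -/
theorem tail_append_of {α : Type} (U L : List α) (h : L ≠ [] → 1 ≤ U.length) :
    (U ++ L).tail = U.tail ++ L := by
  cases U with
  | nil =>
    cases L with
    | nil => rfl
    | cons a L => exact absurd (h (List.cons_ne_nil a L)) (by simp)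
  | cons u U => rfl

/-- **Locality of a statement.** A statement that reads at most `popBound q` symbols deep acts
on `U k ++ L k` as on `U k`, the bottoms carried along, provided `popBound q ≤ |U k|` wherever
`L k ≠ ε`. [cite: PaulEtAl1983, §3 (a block is re-simulated from the contents of the blocks it touches)] -/
theorem stepAux_append : ∀ (q : TM2.Stmt Γ Λ σ) (v : σ) (U L : ∀ k, List (Γ k)),
    (∀ k, L k ≠ [] → TM2Comp.popBound q ≤ (U k).length) →
      TM2.stepAux q v (fun k => U k ++ L k) = appendBot L (TM2.stepAux q v U)
  | TM2.Stmt.push k' f q, v, U, L, h => by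
    simp only [TM2.stepAux]
    have e : update (fun k => U k ++ L k) k' (f v :: (U k' ++ L k')) =
        fun k => update U k' (f v :: U k') k ++ L k := by
      have := update_append U L k' (f v :: U k')
      simpa using this
    rw [e]
    refine stepAux_append q v _ L fun k hk => ?_
    have := h k hk
    simp only [TM2Comp.popBound] at this
    rcases eq_or_ne k k' with rfl | hne
    · simp; omega
    · rw [update_of_ne hne]; exact this
  | TM2.Stmt.peek k' f q, v, U, L, h => by
    simp only [TM2.stepAux]
    have hk' : L k' ≠ [] → 1 ≤ (U k').length := fun hk => by
      have := h k' hk; simp only [TM2Comp.popBound] at this; omega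
    rw [head?_append_of _ _ hk']
    refine stepAux_append q _ U L fun k hk => ?_
    have := h k hk
    simp only [TM2Comp.popBound] at this
    omega
  | TM2.Stmt.pop k' f q, v, U, L, h => by
    simp only [TM2.stepAux]
    have hk' : L k' ≠ [] → 1 ≤ (U k').length := fun hk => by
      have := h k' hk; simp only [TM2Comp.popBound] at this; omega
    rw [head?_append_of _ _ hk', tail_append_of _ _ hk']
    have e : update (fun k => U k ++ L k) k' ((U k').tail ++ L k') =
        fun k => update U k' (U k').tail k ++ L k := update_append U L k' _
    rw [e]
    refine stepAux_append q _ _ L fun k hk => ?_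
    have := h k hk
    simp only [TM2Comp.popBound] at this
    rcases eq_or_ne k k' with rfl | hne
    · simp only [update_self, List.length_tail]; omega
    · rw [update_of_ne hne]; omega
  | TM2.Stmt.load f q, v, U, L, h => by
    simp only [TM2.stepAux]
    exact stepAux_append q _ U L fun k hk => by
      have := h k hk; simpa [TM2Comp.popBound] using this
  | TM2.Stmt.branch p q₁ q₂, v, U, L, h => by
    simp only [TM2.stepAux]
    cases p v
    · exact stepAux_append q₂ v U L fun k hk => by
        have := h k hk; simp only [TM2Comp.popBound] at this
        have := le_max_right (TM2Comp.popBound q₁) (TM2Comp.popBound q₂); omega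
    · exact stepAux_append q₁ v U L fun k hk => by
        have := h k hk; simp only [TM2Comp.popBound] at this
        have := le_max_left (TM2Comp.popBound q₁) (TM2Comp.popBound q₂); omega
  | TM2.Stmt.goto l, v, U, L, _ => by simp [TM2.stepAux, appendBot]
  | TM2.Stmt.halt, v, U, L, _ => by simp [TM2.stepAux, appendBot]

end Stmt

/-! ### One step, the total step, runs -/

variable {tm : FinTM2}

/-- **Locality of one step of a `FinTM2`**: with `machinePopBound` symbols of room above every
hidden bottom, the partial step commutes with appending the bottoms. [cite: PaulEtAl1983, §3] -/
theorem step_append (c : tm.Cfg) (L : ∀ k, List (tm.Γ k))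
    (h : ∀ k, L k ≠ [] → TM2Comp.machinePopBound tm ≤ (c.stk k).length) :
    letI := tm.kDecidableEq
    tm.step (appendBot L c) = (tm.step c).map (appendBot L) := by
  letI := tm.kDecidableEq
  letI := tm.ΛFin
  obtain ⟨_ | l, v, S⟩ := c
  · rfl
  · simp only [FinTM2.step, TM2.step, appendBot_mk, Option.map_some]
    congr 1
    refine stepAux_append (tm.m l) v S L fun k hk => (?_ : _ ≤ _).trans (h k hk)
    exact Finset.le_sup (f := fun l => TM2Comp.popBound (tm.m l)) (Finset.mem_univ l)

/-- The same for the total step `TM2Blocks.stepT`. [folklore] -/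
theorem stepT_append (c : tm.Cfg) (L : ∀ k, List (tm.Γ k))
    (h : ∀ k, L k ≠ [] → TM2Comp.machinePopBound tm ≤ (c.stk k).length) :
    letI := tm.kDecidableEq
    TM2Blocks.stepT tm (appendBot L c) = appendBot L (TM2Blocks.stepT tm c) := by
  letI := tm.kDecidableEq
  unfold TM2Blocks.stepT
  rw [step_append c L h]
  cases tm.step c <;> rfl

/-- **The block re-simulation lemma.** If along the full run from `appendBot L c` the height of
every stack with a hidden bottom is at least `Q + |L k|` before each of the first `n` steps
(`Q = machinePopBound`), then for every `t ≤ n` the full run is the truncated run from `c` with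
the bottoms appended: a time block is determined by its start control and the contents ABOVE the
cut — for the true run, above the lowest height block it touches (`TM2Blocks.lo`).
[cite: PaulEtAl1983, §3] [cite: Santhanam2001, §1 (p. 2)] -/
theorem run_append (c : tm.Cfg) (L : ∀ k, List (tm.Γ k)) (n : ℕ)
    (h : ∀ t, t < n → ∀ k, L k ≠ [] →
      letI := tm.kDecidableEq
      TM2Comp.machinePopBound tm + (L k).length ≤
        ((TM2Blocks.run tm (appendBot L c) t).stk k).length) :
    letI := tm.kDecidableEq
    ∀ t, t ≤ n → TM2Blocks.run tm (appendBot L c) t = appendBot L (TM2Blocks.run tm c t) := by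
  letI := tm.kDecidableEq
  intro t
  induction t with
  | zero => intro _; rfl
  | succ t ih =>
    intro ht
    have ih' := ih (by omega)
    rw [TM2Blocks.run_succ, TM2Blocks.run_succ, ih']
    refine stepT_append _ L fun k hk => ?_
    have := h t (by omega) k hk
    rw [ih'] at this
    simp only [appendBot_stk, List.length_append] at this
    omega

/-- **The block re-simulation lemma, verifier's form.** The same conclusion when the room
condition is checked on the TRUNCATED run from `c` (what a verifier re-simulating the block from
guessed top segments can test): if before each of the first `n` truncated steps every stack with
a hidden bottom has at least `Q` symbols, then the full run is the truncated run with the bottoms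
appended. [cite: PaulEtAl1983, §3] -/
theorem run_append_of_truncated (c : tm.Cfg) (L : ∀ k, List (tm.Γ k)) (n : ℕ)
    (h : ∀ t, t < n → ∀ k, L k ≠ [] →
      TM2Comp.machinePopBound tm ≤ ((TM2Blocks.run tm c t).stk k).length) :
    letI := tm.kDecidableEq
    ∀ t, t ≤ n → TM2Blocks.run tm (appendBot L c) t = appendBot L (TM2Blocks.run tm c t) := by
  letI := tm.kDecidableEq
  intro t
  induction t with
  | zero => intro _; rfl
  | succ t ih =>
    intro ht
    rw [TM2Blocks.run_succ, TM2Blocks.run_succ, ih (by omega)]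
    exact stepT_append _ L fun k hk => h t (by omega) k hk

end TM2Frames

end Literature.Computability.Complexity
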